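import Summits.KontsevichZagierPeriods.KontsevichZagierPeriods.Theses.CompiledSubstitutions

/-!
# Route CompiledSubstitutions — assembly item `CruxAssembly`

Closes item stmt-KontsevichZagierPeriods-14464 of route
`route-KontsevichZagierPeriods-CompiledSubstitutions`: the crux-level assembly
`LegendreSector → ZhouWanKPrimeCubed → ZetaEvenBKC → EulerReflectionRational →
CompiledSectorKernel → KontsevichZagierPeriods` — cruxes 2–6 of the route assemble to the summit.

Pure logic: the glue step (the same term as the landed `compiledSectorGlue_proof`, item
stmt-KontsevichZagierPeriods-14367, inlined here so that this file depends on the route file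
only) instantiates `CompiledSectorKernel` at `S := KZ.relations` (`le_rfl`), where its four
realisability hypotheses are the four cruxes verbatim (`KZ.Equivalent r r'` unfolds by definition
to `KZ.of r - KZ.of r' ∈ KZ.relations`) and its conclusion is `AlgebraicFormTarget`; the route's
deciding theorem `closes` then turns `AlgebraicFormTarget` into the summit statement
`KontsevichZagierPeriods` (dropping the two `IsRational` hypotheses of the KZ-literal conjecture).
-/

-- single-conjunct summit: Sub = Summit, so the namespace segment repeats by design (CONVENTIONS §2)
set_option linter.dupNamespace false

namespace Summit.KontsevichZagierPeriods.KontsevichZagierPeriods.Theorems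

open Summit.KontsevichZagierPeriods.KontsevichZagierPeriods.Theses.CompiledSubstitutions

/-- The crux-level assembly of route CompiledSubstitutions (item
stmt-KontsevichZagierPeriods-14464): the four compiled families (cruxes `LegendreSector`,
`ZhouWanKPrimeCubed`, `ZetaEvenBKC`, `EulerReflectionRational`) together with the kernel
conjecture relative to the compiled sector (`CompiledSectorKernel`) imply the summit statement
`KontsevichZagierPeriods`. Proof: `closes` applied to the kernel hypothesis specialised at
`S := KZ.relations` (the glue term of `compiledSectorGlue_proof`, inlined). -/
theorem cruxAssembly_proof : CruxAssembly := by
  unfold CruxAssembly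
  intro hL hZ hE hR hK
  exact closes (fun _ _ r r' hv => hK _ le_rfl hL hZ hE hR r r' hv)

end Summit.KontsevichZagierPeriods.KontsevichZagierPeriods.Theorems
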